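import Summits.QuantumFields.YangMills.Theorems.LangevinControlUVFemtoCurvatureSkewnessCRatioTransportDefsE
import Summits.QuantumFields.YangMills.Theorems.LangevinControlUVFemtoCurvatureSkewnessCStubRatioFloorChains

/-!
# Crux `FemtoCurvatureSkewnessC` (stmt-QuantumFields-16205), line `ratio-transport`: the Lipschitz transports imply the qualitative forms

Lead `prover-line-stmt-QuantumFields-16205-c2-0` (line lead, cycle 3, 2026-08-16).  First companion proof file of the vocabulary (E)
`LangevinControlUVFemtoCurvatureSkewnessCRatioTransportDefsE.lean` (the reshape v4.1 → v4.2: stubs E_v, E_s in rate-free form).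
Theorems only, no `sorry`, nothing posited; pure real analysis over the landed chains `vol_chain`, `sep_chain` (p123392); no property of
`skewRatioT` is used.

* `volumeModulus_of_volumeTransport` — `C_V (n/L')⁴ (L−L')/L'`-Lipschitz volume transport ⇒ the volume modulus (`η := min 1 (ε/(C_V+1))`).
* `volumeCauchy_of_volumeTransport` — the same ⇒ the large-aspect-ratio Cauchy property (`K := max 8 ⌈2C_V/ε⌉`, dyadic `vol_chain`).
* `separationModulus_of_separationTransport` — `C_S/n`-Lipschitz separation transport ⇒ the separation modulus (`η := ε/(C_S+1)`).
* `volumeEngineQ_of_volumeEngine`, `separationEngineQ_of_separationEngine` — hence v4.1's stubs E_v, E_s imply v4.2's.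
The descent from the qualitative forms and skeleton v4.2's assembly are in the second companion
`LangevinControlUVFemtoCurvatureSkewnessCQualitativeDescent.lean`.
-/

set_option autoImplicit false

noncomputable section

namespace Summit.QuantumFields.YangMills.Cruxes.FemtoCurvatureSkewnessC.RatioTransport

open MeasureTheory Filter Topology
open scoped BigOperators
open Literature.MathematicalPhysics.QuantumFieldTheory
open Summit.QuantumFields.YangMills.Theorems.FemtoCurvatureSkewness.Negative (TwoPointPackage)

/-! ## § Weakening — v4.1's Lipschitz transports imply the qualitative forms -/

section Weakening

variable {G : Type} [Group G] [TopologicalSpace G] [IsTopologicalGroup G] [CompactSpace G]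
  [MeasurableSpace G] [BorelSpace G]

/-- **Lipschitz volume transport ⇒ volume modulus** (`η := min 1 (ε/(C_V + 1))`; one differential step, `(n/L')⁴ ≤ 1`). -/
theorem volumeModulus_of_volumeTransport (r : LatticeRep G) {a : ℝ → ℝ} (h : VolumeTransport r a) :
    VolumeModulus r a := by
  obtain ⟨βv, ℓv, CV₀, hℓv, hvol⟩ := h
  intro ε hε
  set CV : ℝ := max CV₀ 0 with hCVdef
  have hCV : 0 ≤ CV := le_max_right _ _
  have hCV1 : 0 < CV + 1 := by linarith
  refine ⟨βv, ℓv, min 1 (ε / (CV + 1)), hℓv, lt_min one_pos (div_pos hε hCV1), ?_⟩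
  intro L L' _ _ β n hβ hL hn h8 hle hLη
  have hL'pos : (0 : ℝ) < L' := by exact_mod_cast (show 0 < L' by omega)
  have hreal : (L : ℝ) ≤ 2 * (L' : ℝ) := by
    have h1 : (1 + min 1 (ε / (CV + 1))) * (L' : ℝ) ≤ (1 + 1) * (L' : ℝ) :=
      mul_le_mul_of_nonneg_right (by linarith [min_le_left (1 : ℝ) (ε / (CV + 1))]) hL'pos.le
    linarith
  have h2 : L ≤ 2 * L' := by exact_mod_cast hreal
  have hstep := hvol L L' β n hβ hL hn h8 hle h2
  have hratio : ((n : ℝ) / L') ^ 4 ≤ 1 := by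
    apply pow_le_one₀ (by positivity)
    rw [div_le_one hL'pos]
    exact_mod_cast (show n ≤ L' by omega)
  have hfrac0 : 0 ≤ ((L : ℝ) - L') / L' :=
    div_nonneg (by rw [sub_nonneg]; exact_mod_cast hle) hL'pos.le
  have hfrac : ((L : ℝ) - L') / L' ≤ ε / (CV + 1) := by
    rw [div_le_iff₀ hL'pos]
    have h1 : (L : ℝ) - L' ≤ min 1 (ε / (CV + 1)) * L' := by linarith
    exact h1.trans (mul_le_mul_of_nonneg_right (min_le_right _ _) hL'pos.le)
  have hX : 0 ≤ ((n : ℝ) / L') ^ 4 * (((L : ℝ) - L') / L') := mul_nonneg (by positivity) hfrac0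
  calc |skewRatioT r L β n - skewRatioT r L' β n|
      ≤ CV₀ * ((n : ℝ) / L') ^ 4 * (((L : ℝ) - L') / L') := hstep
    _ = CV₀ * (((n : ℝ) / L') ^ 4 * (((L : ℝ) - L') / L')) := by ring
    _ ≤ CV * (((n : ℝ) / L') ^ 4 * (((L : ℝ) - L') / L')) := mul_le_mul_of_nonneg_right (le_max_left _ _) hX
    _ ≤ CV * (1 * (ε / (CV + 1))) := by
        apply mul_le_mul_of_nonneg_left _ hCV
        exact mul_le_mul hratio hfrac hfrac0 zero_le_one
    _ = ε * (CV / (CV + 1)) := by ring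
    _ ≤ ε * 1 := mul_le_mul_of_nonneg_left ((div_le_one hCV1).2 (by linarith)) hε.le
    _ = ε := mul_one ε

/-- **Lipschitz volume transport ⇒ large-aspect-ratio Cauchy property** (`K := max 8 ⌈2C_V/ε⌉`, by the landed dyadic `vol_chain`),
for a nonnegative unit map. -/
theorem volumeCauchy_of_volumeTransport (r : LatticeRep G) {a : ℝ → ℝ} (hpos : ∀ β, 0 < a β)
    (h : VolumeTransport r a) : VolumeCauchy r a := by
  obtain ⟨βv, ℓv, CV₀, hℓv, hvol₀⟩ := h
  intro ε hε
  set CV : ℝ := max CV₀ 0 with hCVdef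
  have hCV : 0 ≤ CV := le_max_right _ _
  have hvol : ∀ (L L' : ℕ) [NeZero L] [NeZero L'] (β : ℝ) (n : ℕ), βv ≤ β → (L : ℝ) * a β ≤ ℓv →
      1 ≤ n → 8 * n ≤ L' → L' ≤ L → L ≤ 2 * L' →
        |skewRatioT r L β n - skewRatioT r L' β n| ≤ CV * ((n : ℝ) / L') ^ 4 * (((L : ℝ) - L') / L') := by
    intro L L' _ _ β n hβ hL hn h8 hle h2
    refine (hvol₀ L L' β n hβ hL hn h8 hle h2).trans ?_
    have hL'pos : (0 : ℝ) < L' := by exact_mod_cast (show 0 < L' by omega)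
    have hX : 0 ≤ ((n : ℝ) / L') ^ 4 * (((L : ℝ) - L') / L') :=
      mul_nonneg (by positivity) (div_nonneg (by rw [sub_nonneg]; exact_mod_cast hle) hL'pos.le)
    calc CV₀ * ((n : ℝ) / L') ^ 4 * (((L : ℝ) - L') / L')
        = CV₀ * (((n : ℝ) / L') ^ 4 * (((L : ℝ) - L') / L')) := by ring
      _ ≤ CV * (((n : ℝ) / L') ^ 4 * (((L : ℝ) - L') / L')) := mul_le_mul_of_nonneg_right (le_max_left _ _) hX
      _ = CV * ((n : ℝ) / L') ^ 4 * (((L : ℝ) - L') / L') := by ring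
  obtain ⟨K₂, hK₂⟩ := exists_nat_ge (2 * CV / ε)
  refine ⟨βv, ℓv, max 8 K₂, hℓv, le_max_left _ _, ?_⟩
  intro L L' _ _ β n hβ hL hn hK hle
  have hKpos : (0 : ℝ) < (max 8 K₂ : ℕ) := by exact_mod_cast (show 0 < max 8 K₂ from lt_of_lt_of_le (by norm_num) (le_max_left _ _))
  have hK1 : (1 : ℝ) ≤ (max 8 K₂ : ℕ) := by exact_mod_cast (show 1 ≤ max 8 K₂ from le_trans (by norm_num) (le_max_left _ _))
  have h8 : 8 * n ≤ L' := le_trans (Nat.mul_le_mul_right n (le_max_left 8 K₂)) hK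
  have hchain := vol_chain r a hCV hvol L β hβ hL (hpos β) n hn (L - L') L' L le_rfl h8 hle le_rfl
  refine hchain.trans ?_
  have hL'pos : (0 : ℝ) < L' := by exact_mod_cast (show 0 < L' by omega)
  have hratio : (n : ℝ) / L' ≤ 1 / (max 8 K₂ : ℕ) := by
    rw [div_le_div_iff₀ hL'pos hKpos, one_mul]
    exact_mod_cast (show n * max 8 K₂ ≤ L' by rw [Nat.mul_comm]; exact hK)
  have hpow : ((n : ℝ) / L') ^ 4 ≤ (1 / (max 8 K₂ : ℕ)) ^ 4 := pow_le_pow_left₀ (by positivity) hratio 4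
  have hinv : (1 / ((max 8 K₂ : ℕ) : ℝ)) ^ 4 ≤ 1 / (max 8 K₂ : ℕ) := by
    rw [div_pow, one_pow]
    apply div_le_div_of_nonneg_left zero_le_one hKpos
    calc ((max 8 K₂ : ℕ) : ℝ) = ((max 8 K₂ : ℕ) : ℝ) ^ 1 := (pow_one _).symm
      _ ≤ ((max 8 K₂ : ℕ) : ℝ) ^ 4 := pow_le_pow_right₀ hK1 (by norm_num)
  have hKε : 2 * CV / (max 8 K₂ : ℕ) ≤ ε := by
    have h1 : 2 * CV / ε ≤ (max 8 K₂ : ℕ) := hK₂.trans (by exact_mod_cast le_max_right 8 K₂)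
    rw [div_le_iff₀ hε] at h1
    rw [div_le_iff₀ hKpos]
    linarith
  calc 2 * CV * ((n : ℝ) / L') ^ 4 ≤ 2 * CV * (1 / (max 8 K₂ : ℕ)) ^ 4 := by gcongr
    _ ≤ 2 * CV * (1 / (max 8 K₂ : ℕ)) := mul_le_mul_of_nonneg_left hinv (by positivity)
    _ = 2 * CV / (max 8 K₂ : ℕ) := by ring
    _ ≤ ε := hKε

/-- **Lipschitz separation transport ⇒ separation modulus** (`η := ε/(C_S + 1)`, by the landed `sep_chain`). -/
theorem separationModulus_of_separationTransport (r : LatticeRep G) {a : ℝ → ℝ} (h : SeparationTransport r a) :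
    SeparationModulus r a := by
  obtain ⟨βs, ℓs, CS₀, hℓs, hsep₀⟩ := h
  intro ε hε
  set CS : ℝ := max CS₀ 0 with hCSdef
  have hCS : 0 ≤ CS := le_max_right _ _
  have hCS1 : 0 < CS + 1 := by linarith
  have hsep : ∀ (L : ℕ) [NeZero L] (β : ℝ) (n : ℕ), βs ≤ β → (L : ℝ) * a β ≤ ℓs →
      1 ≤ n → 8 * (n + 1) ≤ L → |skewRatioT r L β (n + 1) - skewRatioT r L β n| ≤ CS / n := by
    intro L _ β n hβ hL hn h8
    exact (hsep₀ L β n hβ hL hn h8).trans (div_le_div_of_nonneg_right (le_max_left _ _) (by positivity))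
  refine ⟨βs, ℓs, ε / (CS + 1), hℓs, div_pos hε hCS1, ?_⟩
  intro L _ β n n' hβ hL hn hnn' hη h8
  obtain ⟨d, rfl⟩ := Nat.exists_eq_add_of_le hnn'
  have hchain := sep_chain r a hCS hsep L β hβ hL n hn d h8
  refine hchain.trans ?_
  have hnpos : (0 : ℝ) < n := by exact_mod_cast hn
  have hd : (d : ℝ) ≤ ε / (CS + 1) * n := by
    have h1 : ((n + d : ℕ) : ℝ) ≤ (1 + ε / (CS + 1)) * n := hη
    push_cast at h1
    linarith
  calc CS * d / n ≤ CS * (ε / (CS + 1) * n) / n := by gcongr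
    _ = CS * (ε / (CS + 1)) := by rw [← mul_assoc, mul_div_assoc, div_self hnpos.ne', mul_one]
    _ = ε * (CS / (CS + 1)) := by ring
    _ ≤ ε * 1 := mul_le_mul_of_nonneg_left ((div_le_one hCS1).2 (by linarith)) hε.le
    _ = ε := mul_one ε

end Weakening

/-- **v4.1's E_v ⇒ v4.2's E_v** (package maps are positive). -/
theorem volumeEngineQ_of_volumeEngine (h : VolumeEngine) : VolumeEngineQ := by
  intro G _ _ _ _ _ _ hG r a₀ ha₀ hP₀
  have hv := h G hG r a₀ ha₀ hP₀
  obtain ⟨Γ, β₀, ℓ₀, c, C, -, -, hpos₀, -, -⟩ := id hP₀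
  exact ⟨volumeModulus_of_volumeTransport r hv, volumeCauchy_of_volumeTransport r hpos₀ hv⟩

/-- **v4.1's E_s ⇒ v4.2's E_s.** -/
theorem separationEngineQ_of_separationEngine (h : SeparationEngine) : SeparationEngineQ :=
  fun G _ _ _ _ _ _ hG r a₀ ha₀ hP₀ => separationModulus_of_separationTransport r (h G hG r a₀ ha₀ hP₀)

end Summit.QuantumFields.YangMills.Cruxes.FemtoCurvatureSkewnessC.RatioTransport

end
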